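import Summits.QuantumFields.YangMills.Theses.SmallCircleAnchor

/-!
# Sketch — crux-ideate stmt-QuantumFields-8782 (`ConvexGribovBody.ContinuumLegGivenGap`), ideator 1, round 1

(Variant importing the SmallCircleAnchor route file: item stmt-QuantumFields-8782 is SHARED and its decl
`SmallCircleAnchor.ContinuumLegGivenGap` is character-identical to `ConvexGribovBody.ContinuumLegGivenGap`;
used only inside `NecessityChain`. The session-folder `Sketch.lean` imports ConvexGribovBody.)

First lemmas of the two idea cards (elaboration check; `uvWindowUpper_of` and
`exists_rightRecord_ge` are proved, the rest are `Prop` definitions over existing declarations).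

* Card `response-monotonicity-uv-window`: `plaqCov`, `plaqRatio`, `ResponseMonotone` (differential
  form, F–H response), `RatioMonotoneInCoupling` (integrated / TP₂ form), `FreeGluonRatioLimit`
  (β → ∞ endpoint for ratios), `UVWindowUpper` (the conclusion), `uvWindowUpper_of` (composition).
* Card `record-low-docking`: `exists_rightRecord_ge` (right-record selection of the couplings β_k).
-/

open Filter Topology
open Literature.MathematicalPhysics.QuantumFieldTheory

noncomputable section

namespace Summit.QuantumFields.YangMills.Cruxes.ContinuumLegGivenGap.Sketch

variable {G : Type} [Group G] [TopologicalSpace G] [IsTopologicalGroup G] [CompactSpace G]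
  [MeasurableSpace G] [BorelSpace G]

/-- Axis covariance of the curvature species (sum of the six origin plaquettes `Re tr r.ρ(U_p)`) at
coupling `b` on the torus `(2S+1)⁴`, time separation `n`: `G_{b,S}(n)`. -/
def plaqCov (r : LatticeRep G) (b : ℝ) (S n : ℕ) : ℝ :=
  latticeConnectedCorr r.ρ b (2 * S + 1) r.curvature.F r.curvature.F n

/-- The sub-correlation-length ratio `G_{b,S}(n) / G_{b,S}(n')`. -/
def plaqRatio (r : LatticeRep G) (b : ℝ) (S n n' : ℕ) : ℝ :=
  plaqCov r b S n / plaqCov r b S n'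

/-- (RM, differential form) RESPONSE MONOTONICITY: the coupling-response
`R_{b,S}(n) = ∂_b log G_{b,S}(n)` (by Feynman–Hellmann `= Σ_z κ₃(P₀,P_n,P_z)/G(n)`) is non-increasing in
the separation on the window `n₀ ≤ n < n' ≤ W b`, on all large tori. -/
def ResponseMonotone (r : LatticeRep G) (β₀ : ℝ) (n₀ : ℕ) (W : ℝ → ℕ) : Prop :=
  ∀ b : ℝ, β₀ ≤ b → ∃ S₂ : ℕ, ∀ S : ℕ, S₂ ≤ S → ∀ n n' : ℕ, n₀ ≤ n → n < n' → n' ≤ W b →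
    deriv (fun t => Real.log (plaqCov r t S n')) b ≤ deriv (fun t => Real.log (plaqCov r t S n)) b

/-- (RM, integrated / TP₂ form): for `β₀ ≤ b ≤ b'` the ratio `G(n)/G(n')` does not decrease from `b`
to `b'` on the window of the LOWER coupling (W = monotone envelope of `c·ξ_P`). -/
def RatioMonotoneInCoupling (r : LatticeRep G) (β₀ : ℝ) (n₀ : ℕ) (W : ℝ → ℕ) : Prop :=
  ∀ b b' : ℝ, β₀ ≤ b → b ≤ b' → ∀ n n' : ℕ, n₀ ≤ n → n < n' → n' ≤ W b →
    ∃ S₂ : ℕ, ∀ S : ℕ, S₂ ≤ S → plaqRatio r b S n n' ≤ plaqRatio r b' S n n'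

/-- (FG) FREE-GLUON ENDPOINT for ratios: as `B → ∞` (first) on large tori the ratio tends to the
free lattice-gluon value `ρfree n n'` (≍ (n'/n)⁸): the β → ∞ local free-gluon law of card
equipartition-pins-free-gluon-law, read on one quadratic observable. -/
def FreeGluonRatioLimit (r : LatticeRep G) (ρfree : ℕ → ℕ → ℝ) : Prop :=
  ∀ n n' : ℕ, ∀ ε : ℝ, 0 < ε → ∃ B₀ : ℝ, ∀ B : ℝ, B₀ ≤ B → ∃ S₃ : ℕ, ∀ S : ℕ, S₃ ≤ S →
    |plaqRatio r B S n n' - ρfree n n'| ≤ ε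

/-- (UVW) UPPER UV WINDOW at every coupling: `G_{b}(n)/G_{b}(n') ≤ ρfree n n'` (up to ε, on all large
tori) for `n₀ ≤ n < n' ≤ W b` — the (UV_k)-upper input of the hub / the n = 2 part of E0′. -/
def UVWindowUpper (r : LatticeRep G) (β₀ : ℝ) (n₀ : ℕ) (W : ℝ → ℕ) (ρfree : ℕ → ℕ → ℝ) : Prop :=
  ∀ b : ℝ, β₀ ≤ b → ∀ n n' : ℕ, n₀ ≤ n → n < n' → n' ≤ W b → ∀ ε : ℝ, 0 < ε →
    ∃ S₄ : ℕ, ∀ S : ℕ, S₄ ≤ S → plaqRatio r b S n n' ≤ ρfree n n' + ε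

/-- The flow-from-the-free-endpoint composition: (RM, integrated) ∧ (FG) ⇒ (UVW). Pure logic. -/
theorem uvWindowUpper_of (r : LatticeRep G) (β₀ : ℝ) (n₀ : ℕ) (W : ℝ → ℕ) (ρfree : ℕ → ℕ → ℝ)
    (hRM : RatioMonotoneInCoupling r β₀ n₀ W) (hFG : FreeGluonRatioLimit r ρfree) :
    UVWindowUpper r β₀ n₀ W ρfree := by
  intro b hb n n' hn hnn' hW ε hε
  obtain ⟨B₀, hB₀⟩ := hFG n n' ε hε
  obtain ⟨S₃, hS₃⟩ := hB₀ (max b B₀) (le_max_right _ _)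
  obtain ⟨S₂, hS₂⟩ := hRM b (max b B₀) hb (le_max_left _ _) n n' hn hnn' hW
  refine ⟨max S₂ S₃, fun S hS => ?_⟩
  have h1 := hS₂ S (le_trans (le_max_left _ _) hS)
  have h2 := hS₃ S (le_trans (le_max_right _ _) hS)
  have h3 : plaqRatio r (max b B₀) S n n' ≤ ρfree n n' + ε := by
    have := (abs_le.mp h2).2
    linarith
  exact le_trans h1 h3

/-- RIGHT-RECORD SELECTION (card record-low-docking; used by the window of card A): a continuous
function tending to `+∞` attains, beyond any `M`, a value that it never undercuts later — so the
couplings `β_k` of the scheme may be placed where the monotone envelope of `ξ_P` equals `ξ_P`. -/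
theorem exists_rightRecord_ge {f : ℝ → ℝ} (hf : Continuous f)
    (htop : Tendsto f atTop atTop) (M : ℝ) :
    ∃ β : ℝ, M ≤ β ∧ ∀ b : ℝ, β ≤ b → f β ≤ f b := by
  obtain ⟨T, hT⟩ := Filter.eventually_atTop.mp (htop.eventually_ge_atTop (f M + 1))
  have hMT' : M ≤ max T M := le_max_right _ _
  have hne : (Set.Icc M (max T M)).Nonempty := ⟨M, le_rfl, hMT'⟩
  obtain ⟨β, hβmem, hβmin⟩ := isCompact_Icc.exists_isMinOn hne hf.continuousOn
  refine ⟨β, hβmem.1, fun b hb => ?_⟩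
  by_cases hbT : b ≤ max T M
  · exact (isMinOn_iff.mp hβmin) b ⟨le_trans hβmem.1 hb, hbT⟩
  · have hb' : T ≤ b := le_trans (le_max_left _ _) (le_of_lt (lt_of_not_ge hbT))
    have h1 : f M + 1 ≤ f b := hT b hb'
    have h2 : f β ≤ f M := (isMinOn_iff.mp hβmin) M ⟨le_rfl, hMT'⟩
    linarith


/-- PLAQUETTE SATURATION along a scheme `(β_k)` with all-observable rates `(Δ_k)` (card
record-low-docking, the one new IR stub of 8782): the curvature species does not decay faster than
`C·Δ_k` per lattice step — `m_P(β_k) ≤ C Δ_full(β_k)` in lower-bound form (no rate functional needed). -/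
def PlaquetteSaturationAlong (r : LatticeRep G) (β : ℕ → ℝ) (Δ : ℕ → ℝ) : Prop :=
  ∃ C c₀ : ℝ, ∃ n₀ : ℕ, 0 < c₀ ∧ ∀ᶠ k in atTop, ∃ S₀ : ℕ, ∀ S : ℕ, S₀ ≤ S → ∀ n : ℕ, n₀ ≤ n → n ≤ S →
    c₀ * Real.exp (-(C * Δ k * n)) * plaqCov r (β k) S n₀ ≤ plaqCov r (β k) S n

/-- UNIFORM MASSIVENESS of the Wilson theory of `r` on ALL couplings `β ≥ 0`: one rate `m₀ > 0`, with
constants depending on the pair of observables but not on `β` (the frozen-ξ leaf). -/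
def UniformlyMassive (r : LatticeRep G) : Prop :=
  ∃ m₀ : ℝ, 0 < m₀ ∧ ∀ A B : YMSpecies G, ∃ C : ℝ, ∀ b : ℝ, 0 ≤ b → ∃ S₁ : ℕ, ∀ S n : ℕ,
    S₁ ≤ S → n ≤ S → |latticeConnectedCorr r.ρ b (2 * S + 1) A.F B.F n| ≤ C * Real.exp (-(m₀ * n))

omit [MeasurableSpace G] [BorelSpace G] in
/-- NECESSITY CHAIN (card record-low-docking): any proof of the crux proves, for every compact simple
`G`, that SOME faithful representation's Wilson theory is not uniformly massive on `[0, ∞)` — an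
unconditional `sup_β ξ = ∞` (via `Literature.Barriers.QuantumFields.FixedCouplingUltralocality`).
Stated, not proved here. -/
def NecessityChain : Prop :=
  Summit.QuantumFields.YangMills.Theses.SmallCircleAnchor.ContinuumLegGivenGap →
    ∀ (G : Type) [Group G] [TopologicalSpace G] [IsTopologicalGroup G] [CompactSpace G],
      IsCompactSimpleLieGroup G →
        letI : MeasurableSpace G := borel G
        haveI : BorelSpace G := ⟨rfl⟩
        ∃ r : LatticeRep G, ¬ UniformlyMassive r

end Summit.QuantumFields.YangMills.Cruxes.ContinuumLegGivenGap.Sketch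

end
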